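/-
Origin: expansion seat `planner-pub-hodgecm-pohl-g15-0`, handover #11 2026-08-18T16:19:39Z (md5 5bf75d50892de65b23d2bc7767d155f0, 263 l.; RUN-32 CANDIDATE ROW, ON REQUEST ONLY — TREE-SHAPE SPLIT (≤400 l.) of the pohl lineage, source lines verbatim; REPLACES HodgeCM/Proofs/Pohlmann/NonGaloisWitness.lean in place (module name kept ⇒ no importer edits); lands AFTER NonGaloisWitnessCubic; rewrites import Pohl15.NonGaloisWitnessCubic -> HodgeCM.Proofs.Pohlmann.NonGal (`HOME/pub-hodgecm-pohl-g15/lean/Pohl15/NonGaloisWitness.lean`, md5 5bf75d50, 263 lines);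
landed by the packager successor (mc-unitary-1-g3, gen-8 kit) in gate run 32 REPLACES the earlier landed copy of `HodgeCM/Proofs/Pohlmann/NonGaloisWitness.lean` (import ^import Pohl15\.NonGaloisWitnessCubic[ \t]*$→import HodgeCM.Proofs.Pohlmann.NonGaloisWitnessCubic ×1).
-/
/-
Copyright: pub-hodgecm formalisation cell (harness21, 2026). New file (not vendored).
Origin: HOME/pub-hodgecm-pohl-g15/lean/Pohl15/NonGaloisWitness.lean — session planner-pub-hodgecm-pohl-g15-0 (unit pub-hodgecm-pohl-g15),
EXPANSION part (b) `PohlmannSpan`, generation 15: TREE-SHAPE STAGING under the 400-line rule of lean/CONVENTIONS.md §2 — part 2/2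
of the split of `HodgeCM/Proofs/Pohlmann/NonGaloisWitness.lean` (pohl-g11, gate run 29; 463 l., md5 d77cf33d8b57): source lines 241–463 VERBATIM; the module docstring below is the source's, with one `Layout` sentence appended.
Intended final place: `HodgeCM/Proofs/Pohlmann/NonGaloisWitness.lean` (module `HodgeCM.Proofs.Pohlmann.NonGaloisWitness`); WIP import `Pohl15.NonGaloisWitnessCubic` → `HodgeCM.Proofs.Pohlmann.NonGaloisWitnessCubic` on landing.  The LAST part keeps the old module name, so no importer changes.
-/
import Summits.HodgeConjecture.HodgeCM.Proofs.Pohlmann.NonGaloisWitnessCubic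

/-!
# A concrete CM field with `Aut = {1, c}`: the naive Pohlmann span fails unconditionally

`NonGaloisIndex.lean` / `NonGaloisInduced.lean` (pohl-g9) refute the BODY of `Universe.PohlmannSpan` with the OLD index set
(`IsHodgeWeight`, the `g·(n+1)`-element Hodge weights) at `p = 1` for every CM field `F` with `Aut(F/ℚ) = {1, c}`, `[F:ℚ] ≥ 4`,
receiving a ring map from a field with exactly two complex embeddings — CONDITIONALLY on such an `F`.  This file supplies one, in the
kernel, so the refutation becomes unconditional:

* `SexticCM.K₂ = ℚ(β₀, i) ⊂ ℂ`, the compositum of toy2's totally real cubic field `F = ℚ(β₀)` (`β₀ = 2 - α₀`, `α₀` a root of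
  `x³ - 4x + 1`, discriminant `229`; `Model/SexticCM/`) with `ℚ(i)`: a CM field of degree `6` (`instIsCMFieldK₂`, `finrank_K₂`);
* `SexticCM.α_not_mem_F` — `F` is NOT normal: the other two roots `α₁, α₂` are not in `F` (else `√229 ∈ F`, and `2 ∤ 3`);
  hence `SexticCM.β_not_mem_K₂` and `SexticCM.autPair_K₂ : NonGalois.AutPair K₂` (`Aut(K₂/ℚ) = {1, c}`), `SexticCM.not_isGalois_K₂`;
* `Universe.not_naivePohlmannSpan`: in every universe with the model axioms and N1–N4,
  `¬ ∀ F n Θ p, U.NaivePohlmannSpanAt F Θ p` — the statement of `PohlmannSpan` with its two hypotheses on `F` deleted is FALSE;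
  and `Universe.not_naivePohlmannSpan_of_six_le`: keeping only `6 ≤ [F:ℚ]` does not rescue it (`[K₂:ℚ] = 6`), i.e. in
  `PohlmannSpan` (proved: `pohlmannSpan_of_facts`, WeightHodge.lean) the hypothesis `IsGalois ℚ F` is the load-bearing one, while the
  corrected index set `IsHodgeWeightC` needs neither (`pohlmannSpanCM_of_facts`, AnyCMField.lean; restated at `K₂` below).

Nothing is cited; everything is kernel-checked from toy2's `SexticCM` layer and pohl-g9's `not_naivePohlmannSpanAt_subfieldType`.

Layout (2026-08-18, tree 400-line rule): the cubic field `F = ℚ(β₀)` and the construction of `K₂ = F(i)` (former first half of this file) are now `NonGaloisWitnessCubic.lean`, imported here; all statements verbatim.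
-/

noncomputable section

open Polynomial IntermediateField NumberField NumberField.ComplexEmbedding

namespace HodgeCM

namespace SexticCM

/-! ### `K₂ / F` is a CM extension -/

/-- (Ported verbatim from the HodgeCMPerL package; no docstring in the source.) -/
instance algFK₂ : Algebra F K₂ := (IntermediateField.inclusion F_le_K₂).toRingHom.toAlgebra

/-- (Ported verbatim from the HodgeCMPerL package; no docstring in the source.) -/
instance istFK₂ : IsScalarTower ℚ F K₂ := IsScalarTower.of_algebraMap_eq fun _ => rfl

/-- (Ported verbatim from the HodgeCMPerL package; no docstring in the source.) -/
theorem finrank_FK₂ : Module.finrank F K₂ = 2 := by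
  have h := Module.finrank_mul_finrank ℚ F K₂
  rw [finrank_F, finrank_K₂] at h
  omega

/-- (Ported verbatim from the HodgeCMPerL package; no docstring in the source.) -/
instance instIsQuadraticExtensionFK₂ : Algebra.IsQuadraticExtension F K₂ where
  finrank_eq_two' := finrank_FK₂

/-- `K₂ = ℚ(β₀, i)` is a CM field (totally complex quadratic over the totally real `F = ℚ(β₀)`). -/
instance instIsCMFieldK₂ : IsCMField K₂ := IsCMField.ofCMExtension F K₂

/-- (Ported verbatim from the HodgeCMPerL package; no docstring in the source.) -/
theorem coe_conjAlgEquiv (x : K₂) : ((conjAlgEquiv K₂ x : K₂) : ℂ) = (starRingEnd ℂ) (x : ℂ) := by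
  rw [conjAlgEquiv_apply]
  exact IsCMField.complexEmbedding_complexConj K₂ (algebraMap K₂ ℂ) x

/-- (Ported verbatim from the HodgeCMPerL package; no docstring in the source.) -/
theorem conjAlgEquiv_bK₂ : conjAlgEquiv K₂ bK₂ = bK₂ :=
  Subtype.ext (by rw [coe_conjAlgEquiv, coe_bK₂, Complex.conj_ofReal])

/-- (Ported verbatim from the HodgeCMPerL package; no docstring in the source.) -/
theorem conjAlgEquiv_iK₂ : conjAlgEquiv K₂ iK₂ = -iK₂ :=
  Subtype.ext (by rw [coe_conjAlgEquiv, coe_iK₂, Complex.conj_I]; rfl)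

/-! ### `Aut(K₂/ℚ) = {1, c}` -/

/-- The conjugation-fixed numbers, as an intermediate field of `ℂ / ℚ`. -/
def conjFixed : IntermediateField ℚ ℂ where
  carrier := {x | (starRingEnd ℂ) x = x}
  mul_mem' := by intro a b ha hb; simp_all
  one_mem' := by simp
  add_mem' := by intro a b ha hb; simp_all
  zero_mem' := by simp
  algebraMap_mem' := by intro q; simp
  inv_mem' := by intro a ha; simp_all

/-- (Ported verbatim from the HodgeCMPerL package; no docstring in the source.) -/
theorem mem_conjFixed {x : ℂ} : x ∈ conjFixed ↔ (starRingEnd ℂ) x = x := Iff.rfl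

/-- (Ported verbatim from the HodgeCMPerL package; no docstring in the source.) -/
theorem aeval_β_g3 (k : Fin 3) : aeval ((β k : ℝ) : ℂ) g3 = 0 := by
  have h : ((β k : ℝ) : ℂ) ^ 3 - 6 * ((β k : ℝ) : ℂ) ^ 2 + 8 * ((β k : ℝ) : ℂ) - 1 = 0 := by
    rw [g3_prod]; fin_cases k <;> simp
  simpa only [g3, map_sub, map_add, map_mul, map_pow, aeval_X, map_one, map_ofNat] using h

/-- (Ported verbatim from the HodgeCMPerL package; no docstring in the source.) -/
theorem isIntegral_β (k : Fin 3) : IsIntegral ℚ ((β k : ℝ) : ℂ) :=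
  ⟨g3, g3_monic, by simpa [aeval_def] using aeval_β_g3 k⟩

/-- For `k ≠ 0`, `β_k ∉ K₂`: otherwise `ℚ(β₀, β_k)` (`3 < [ℚ(β₀, β_k):ℚ] ∣ 6`) would be all of `K₂`, yet it consists of real
numbers and `i ∈ K₂`. -/
theorem β_not_mem_K₂ {k : Fin 3} (hk : k ≠ 0) : ((β k : ℝ) : ℂ) ∉ K₂ := by
  intro hmem
  set M : IntermediateField ℚ ℂ := ℚ⟮((β 0 : ℝ) : ℂ), ((β k : ℝ) : ℂ)⟯ with hM
  haveI : FiniteDimensional ℚ M := finiteDimensional_adjoin fun x hx => by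
    rcases Set.mem_insert_iff.mp hx with rfl | hx
    · exact isIntegral_b
    · rw [Set.mem_singleton_iff.mp hx]; exact isIntegral_β k
  have hβk : ((β k : ℝ) : ℂ) ∈ M := subset_adjoin ℚ _ (Set.mem_insert_of_mem _ rfl)
  have hFM : F ≤ M := adjoin_simple_le_iff.mpr (subset_adjoin ℚ _ (Set.mem_insert _ _))
  have hMK : M ≤ K₂ :=
    adjoin_le_iff.mpr (Set.insert_subset_iff.mpr ⟨β0_mem_K₂, Set.singleton_subset_iff.mpr hmem⟩)
  have hMreal : M ≤ conjFixed :=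
    adjoin_le_iff.mpr (Set.insert_subset_iff.mpr
      ⟨Complex.conj_ofReal _, Set.singleton_subset_iff.mpr (Complex.conj_ofReal _)⟩)
  have h3 : 3 ∣ Module.finrank ℚ M := by simpa only [finrank_F] using finrank_dvd_of_le_right hFM
  have h6 : Module.finrank ℚ M ∣ 6 := by simpa only [finrank_K₂] using finrank_dvd_of_le_right hMK
  have hle6 : Module.finrank ℚ M ≤ 6 := Nat.le_of_dvd (by norm_num) h6
  have hpos : 0 < Module.finrank ℚ M := Module.finrank_pos
  have hne3 : Module.finrank ℚ M ≠ 3 := fun h3' => by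
    have hFM' : F = M := eq_of_le_of_finrank_eq hFM (by rw [finrank_F, h3'])
    exact β_not_mem_F hk (by rw [hFM']; exact hβk)
  have hM6 : Module.finrank ℚ M = 6 := by omega
  have hMK' : M = K₂ := eq_of_le_of_finrank_eq hMK (by rw [hM6, finrank_K₂])
  have hI : Complex.I ∈ M := by rw [hMK']; exact I_mem_K₂
  have hc := hMreal hI
  rw [mem_conjFixed, Complex.conj_I] at hc
  exact neg_I_ne_I hc

/-- Every `g ∈ Aut(K₂/ℚ)` fixes `β₀` … -/
theorem aut_bK₂ (g : K₂ ≃ₐ[ℚ] K₂) : g bK₂ = bK₂ := by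
  obtain ⟨k, hk⟩ := emb_bK₂ ((algebraMap K₂ ℂ).comp g.toAlgHom.toRingHom)
  change ((g bK₂ : K₂) : ℂ) = ((β k : ℝ) : ℂ) at hk
  by_cases hk0 : k = 0
  · subst hk0
    exact Subtype.ext hk
  · exact absurd (by rw [← hk]; exact (g bK₂).2) (β_not_mem_K₂ hk0)

/-- … and sends `i ↦ ±i`. -/
theorem aut_iK₂ (g : K₂ ≃ₐ[ℚ] K₂) : g iK₂ = iK₂ ∨ g iK₂ = -iK₂ := by
  have h := emb_iK₂ ((algebraMap K₂ ℂ).comp g.toAlgHom.toRingHom)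
  change ((g iK₂ : K₂) : ℂ) = Complex.I ∨ ((g iK₂ : K₂) : ℂ) = -Complex.I at h
  rcases h with h | h
  · exact .inl (Subtype.ext h)
  · exact .inr (Subtype.ext (by rw [h]; rfl))

/-- An automorphism of `K₂ = ℚ(β₀, i)` is determined by the images of `β₀` and `i`. -/
theorem aut_ext {g₁ g₂ : K₂ ≃ₐ[ℚ] K₂} (hb : g₁ bK₂ = g₂ bK₂) (hi : g₁ iK₂ = g₂ iK₂) : g₁ = g₂ := by
  apply AlgEquiv.coe_toAlgHom_injective
  apply adjoin_algHom_ext ℚ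
  intro x hx
  rcases Set.mem_insert_iff.mp hx with rfl | hx
  · exact hb
  · rw [Set.mem_singleton_iff] at hx
    subst hx
    exact hi

/-- **`Aut(K₂/ℚ) = {1, c}`.** -/
theorem autPair_K₂ : NonGalois.AutPair K₂ := by
  intro g
  rcases aut_iK₂ g with hi | hi
  · exact .inl (aut_ext (aut_bK₂ g) hi)
  · exact .inr (aut_ext ((aut_bK₂ g).trans conjAlgEquiv_bK₂.symm) (hi.trans conjAlgEquiv_iK₂.symm))

/-- `K₂ / ℚ` is not Galois (`|Aut(K₂/ℚ)| ≤ 2 < 6 = [K₂:ℚ]`). -/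
theorem not_isGalois_K₂ : ¬ IsGalois ℚ K₂ := by
  intro hG
  have hcard : Nat.card (K₂ ≃ₐ[ℚ] K₂) = 6 := by rw [IsGalois.card_aut_eq_finrank, finrank_K₂]
  have hs : Function.Surjective (fun b : Bool => if b then (AlgEquiv.refl : K₂ ≃ₐ[ℚ] K₂) else conjAlgEquiv K₂) := by
    intro g
    rcases autPair_K₂ g with rfl | rfl
    exacts [⟨true, rfl⟩, ⟨false, rfl⟩]
  have hle : Nat.card (K₂ ≃ₐ[ℚ] K₂) ≤ Nat.card Bool := Nat.card_le_card_of_surjective _ hs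
  rw [hcard, Nat.card_eq_fintype_card, Fintype.card_bool] at hle
  omega

/-! ### The imaginary quadratic subfield `ℚ(i) ⊂ K₂` -/

/-- `i ∈ ℚ(i)` as an element -/
def genI : Qi := ⟨Complex.I, I_mem_Qi⟩

/-- (Ported verbatim from the HodgeCMPerL package; no docstring in the source.) -/
@[simp] theorem coe_genI : ((genI : Qi) : ℂ) = Complex.I := rfl

/-- (Ported verbatim from the HodgeCMPerL package; no docstring in the source.) -/
theorem genI_sq : (genI : Qi) ^ 2 = -1 := by
  apply (algebraMap Qi ℂ).injective
  simp only [map_pow, map_neg, map_one, IntermediateField.algebraMap_apply, coe_genI, Complex.I_sq]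

/-- (Ported verbatim from the HodgeCMPerL package; no docstring in the source.) -/
theorem ringHom_Qi_ext {k k' : Qi →+* ℂ} (h : k genI = k' genI) : k = k' := by
  suffices hs : k.toRatAlgHom = k'.toRatAlgHom by
    have := congrArg AlgHom.toRingHom hs
    simpa using this
  apply adjoin_algHom_ext ℚ
  intro x hx
  rw [Set.mem_singleton_iff] at hx
  subst hx
  exact h

/-- `ℚ(i)` has exactly the two complex embeddings `id ≠ conj`. -/
theorem emb_Qi (k : Qi →+* ℂ) : k = algebraMap Qi ℂ ∨ k = conjugate (algebraMap Qi ℂ) := by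
  have h := congrArg k genI_sq
  rw [map_pow, map_neg, map_one] at h
  rcases eq_I_or_eq_neg_I_of_sq h with h1 | h1
  · exact .inl (ringHom_Qi_ext (by rw [h1]; rfl))
  · refine .inr (ringHom_Qi_ext ?_)
    rw [h1, conjugate_coe_eq]
    change -Complex.I = (starRingEnd ℂ) Complex.I
    rw [Complex.conj_I]

/-- (Ported verbatim from the HodgeCMPerL package; no docstring in the source.) -/
theorem conjugate_Qi_ne : conjugate (algebraMap Qi ℂ) ≠ algebraMap Qi ℂ := by
  intro h
  have h' := RingHom.congr_fun h genI
  rw [conjugate_coe_eq] at h'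
  change (starRingEnd ℂ) Complex.I = Complex.I at h'
  rw [Complex.conj_I] at h'
  exact neg_I_ne_I h'

/-- `K₂` bundled as a `CMField`. -/
def K₂CM : CMField := ⟨K₂⟩

/-- (Ported verbatim from the HodgeCMPerL package; no docstring in the source.) -/
theorem finrank_K₂CM : Module.finrank ℚ K₂CM = 6 := finrank_K₂

/-- The inclusion `ℚ(i) ↪ K₂`. -/
def QiToK₂ : Qi →+* K₂CM := (IntermediateField.inclusion Qi_le_K₂).toRingHom

end SexticCM

namespace Universe

open Literature.AlgebraicGeometry.Motives (CMType)
open NonGalois SexticCM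

variable {U : Universe}

/-- The CM type of `K₂` induced from `ℚ(i)`: `Θ₂ = {s : K₂ → ℂ | s|_{ℚ(i)} = id}`. -/
def thetaK₂ : CMType K₂CM := subfieldType QiToK₂ (algebraMap Qi ℂ) emb_Qi conjugate_Qi_ne

/-- The naive Pohlmann span FAILS at `(K₂, Θ₂, p = 1)` in every universe with the model axioms and N1–N4. -/
theorem not_naivePohlmannSpanAt_K₂ (M : U.ModelAxioms) (hN1 : U.Fact_cupExterior) (hN2 : U.Fact_cup_hodge)
    (hN3 : U.Fact_pull_H0) (hN4 : U.Fact_hodge_F0) :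
    ¬ U.NaivePohlmannSpanAt K₂CM (fun _ : Fin 1 => thetaK₂) 1 :=
  not_naivePohlmannSpanAt_subfieldType M hN1 hN2 hN3 hN4 K₂CM autPair_K₂ (by rw [finrank_K₂CM]; norm_num)
    QiToK₂ (algebraMap Qi ℂ) emb_Qi conjugate_Qi_ne

/-- **`PohlmannSpan` without its hypotheses on `F` is false**: in every universe with the model axioms and N1–N4 the naive
span (old index set `IsHodgeWeight`) fails for some CM field, CM type and degree — namely `(K₂, Θ₂, p = 1)`. -/
theorem not_naivePohlmannSpan (M : U.ModelAxioms) (hN1 : U.Fact_cupExterior) (hN2 : U.Fact_cup_hodge)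
    (hN3 : U.Fact_pull_H0) (hN4 : U.Fact_hodge_F0) :
    ¬ ∀ (F : CMField) (n : ℕ) (Θ : Fin (n + 1) → CMType F) (p : ℕ), U.NaivePohlmannSpanAt F Θ p :=
  fun h => not_naivePohlmannSpanAt_K₂ M hN1 hN2 hN3 hN4 (h K₂CM 0 _ 1)

/-- The degree hypothesis alone does not rescue it (`[K₂:ℚ] = 6`): of the two hypotheses on `F` in `PohlmannSpan`
(`pohlmannSpan_iff_naive`), `IsGalois ℚ F` is the load-bearing one. -/
theorem not_naivePohlmannSpan_of_six_le (M : U.ModelAxioms) (hN1 : U.Fact_cupExterior) (hN2 : U.Fact_cup_hodge)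
    (hN3 : U.Fact_pull_H0) (hN4 : U.Fact_hodge_F0) :
    ¬ ∀ (F : CMField), 6 ≤ Module.finrank ℚ F →
      ∀ (n : ℕ) (Θ : Fin (n + 1) → CMType F) (p : ℕ), U.NaivePohlmannSpanAt F Θ p :=
  fun h => not_naivePohlmannSpanAt_K₂ M hN1 hN2 hN3 hN4 (h K₂CM finrank_K₂CM.ge 0 _ 1)

/-- Contrast: at the same `(K₂, Θ₂, p)` the CORRECTED span (index set `IsHodgeWeightC`) holds — `pohlmannSpanCM_at`, any CM field. -/
theorem pohlmannSpanCM_at_K₂ (M : U.ModelAxioms) (hN1 : U.Fact_cupExterior) (hN2 : U.Fact_cup_hodge)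
    (hN3 : U.Fact_pull_H0) (hN4 : U.Fact_hodge_F0) (p : ℕ) :
    (U.hodgeClassesOf (U.cmProd K₂CM (fun _ : Fin 1 => thetaK₂)) p).map
        Literature.AlgebraicGeometry.Motives.HodgeStructure.ofRat ≤
      (Submodule.span ℂ {x : U.CohC (U.cmProd K₂CM (fun _ : Fin 1 => thetaK₂)) (2 * p) |
        ∃ S : Fin 1 → Finset ((K₂CM : Type) →+* ℂ), IsHodgeWeightC (fun _ : Fin 1 => thetaK₂) p S ∧
          U.IsWeightVector K₂CM (fun _ : Fin 1 => thetaK₂) S (2 * p) x}).restrictScalars ℚ :=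
  pohlmannSpanCM_at M hN1 hN2 hN3 hN4 K₂CM _ p

end Universe

end HodgeCM

end
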